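import Summits.Parity.BatemanHorn.Theorems.SoloInformedDivisorStoreyGeneral

/-!
# Erdős-type bounds for `∑_{n≤x} τ(|g(n)|)` read off the storey identity — every irreducible `g` of degree `≥ 2`

Solo informed line (Parity / Bateman–Horn), session 136.  Corollaries of
`SoloInformedDivisorStoreyGeneral.exists_abs_polyDivisorSum_sub_located_sub_log_le_of_two_le`
(`|S_g(x) − 2Mid_g(x) − 2A_g x log x| ≤ Cx`, no growth hypotheses) and `Mid_g ≥ 0`:

* `exists_polyDivisorSum_lower` — the EXPLICIT unconditional lower bound `S_g(x) ≥ 2A_g·x log x − Cx` (`x ≥ 2`), hence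
  `eventually_le_polyDivisorSum_div` — `S_g(x)/(x log x) ≥ 2A_g − ε` eventually (a kernel-checked lower-bound half of
  Erdős's `x log x ≪ ∑τ(g(n)) ≪ x log x`, with the constant `2A_g`);
* `polyDivisorSum_upper_iff_located_upper` — an upper bound `S_g(x) ≤ K x log x` (`x ≥ 2`) holds for some `K` iff
  `Mid_g(x) ≤ K' x log x` holds for some `K'`: Erdős's upper bound is EQUIVALENT to a Chebyshev bound for the located root count;
* `polyDivisorSum_sub_log_upper_iff` — likewise `S_g − 2A_g x log x ≤ Kx ⟺ Mid_g ≤ K'x` (the "`O(x)` secondary term" form).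
-/

open Finset Real Polynomial Filter Topology

namespace Summit.Parity.BatemanHorn.Theorems

/-- **Explicit lower bound**: for every irreducible `g` of degree `≥ 2` there is `C` with
`2A_g·x log x − Cx ≤ ∑_{n≤x} τ(|g(n)|)` for all `x ≥ 2`. [this work] -/
theorem exists_polyDivisorSum_lower {g : ℤ[X]} (hirr : Irreducible g) (hdeg : 2 ≤ g.natDegree) :
    ∃ C : ℝ, ∀ x : ℕ, 2 ≤ x →
      2 * rootLevelConst g * (x : ℝ) * Real.log x - C * x ≤ (polyDivisorSum g x : ℝ) := by
  obtain ⟨C, hC⟩ := exists_abs_polyDivisorSum_sub_located_sub_log_le_of_two_le hirr hdeg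
  refine ⟨C, fun x hx => ?_⟩
  have h1 := hC x hx
  have h0 : (0 : ℝ) ≤ polyLocatedRootCount g x := Nat.cast_nonneg _
  rw [abs_le] at h1
  linarith [h1.1]

/-- **Lower bound, limit form**: for every `ε > 0`, eventually `2A_g − ε ≤ S_g(x)/(x log x)`. [this work] -/
theorem eventually_le_polyDivisorSum_div {g : ℤ[X]} (hirr : Irreducible g) (hdeg : 2 ≤ g.natDegree)
    {ε : ℝ} (hε : 0 < ε) :
    ∀ᶠ x : ℕ in atTop, 2 * rootLevelConst g - ε ≤ (polyDivisorSum g x : ℝ) / ((x : ℝ) * Real.log x) := by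
  obtain ⟨C, hC⟩ := exists_polyDivisorSum_lower hirr hdeg
  -- `C / log x → 0`, so eventually `C / log x ≤ ε`
  have hlog : Tendsto (fun x : ℕ => Real.log (x : ℝ)) atTop atTop :=
    Real.tendsto_log_atTop.comp tendsto_natCast_atTop_atTop
  have h1 : Tendsto (fun x : ℕ => C / Real.log (x : ℝ)) atTop (𝓝 0) := tendsto_const_nhds.div_atTop hlog
  have h2 : ∀ᶠ x : ℕ in atTop, C / Real.log (x : ℝ) ≤ ε := (h1.eventually (ge_mem_nhds hε)).mono fun x hx => hx
  filter_upwards [h2, eventually_ge_atTop 2] with x hCε hx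
  have hx' : (2 : ℝ) ≤ x := by exact_mod_cast hx
  have hxpos : (0 : ℝ) < x := by linarith
  have hlogpos : 0 < Real.log (x : ℝ) := Real.log_pos (by linarith)
  have hden : 0 < (x : ℝ) * Real.log x := mul_pos hxpos hlogpos
  rw [le_div_iff₀ hden]
  have h3 := hC x hx
  -- `C x = (C / log x) · x log x ≤ ε · x log x`
  have h4 : C * (x : ℝ) ≤ ε * ((x : ℝ) * Real.log x) := by
    have : C * (x : ℝ) = C / Real.log (x : ℝ) * ((x : ℝ) * Real.log x) := by
      field_simp
    rw [this]
    exact mul_le_mul_of_nonneg_right hCε hden.le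
  nlinarith

/-- **Erdős's upper bound ⟺ a Chebyshev bound for the located root count**: for every irreducible `g` of degree `≥ 2`,
`(∃ K, ∀ x ≥ 2, S_g(x) ≤ K x log x) ⟺ (∃ K', ∀ x ≥ 2, Mid_g(x) ≤ K' x log x)`. [this work] -/
theorem polyDivisorSum_upper_iff_located_upper {g : ℤ[X]} (hirr : Irreducible g) (hdeg : 2 ≤ g.natDegree) :
    (∃ K : ℝ, ∀ x : ℕ, 2 ≤ x → (polyDivisorSum g x : ℝ) ≤ K * ((x : ℝ) * Real.log x)) ↔
      (∃ K : ℝ, ∀ x : ℕ, 2 ≤ x → (polyLocatedRootCount g x : ℝ) ≤ K * ((x : ℝ) * Real.log x)) := by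
  obtain ⟨C, hC⟩ := exists_abs_polyDivisorSum_sub_located_sub_log_le_of_two_le hirr hdeg
  have hl2 : (1 : ℝ) / 2 < Real.log 2 := by
    have := Real.log_two_gt_d9; norm_num at this ⊢; linarith
  -- on `x ≥ 2`: `x ≤ x log x / log 2 ≤ 2 · x log x`
  have hxlog : ∀ x : ℕ, 2 ≤ x → (x : ℝ) ≤ 2 * ((x : ℝ) * Real.log x) := by
    intro x hx
    have hx' : (2 : ℝ) ≤ x := by exact_mod_cast hx
    have hlog2 : Real.log 2 ≤ Real.log (x : ℝ) := Real.log_le_log (by norm_num) hx'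
    nlinarith
  constructor
  · rintro ⟨K, hK⟩
    refine ⟨(K + |rootLevelConst g| * 2 + 2 * |C|) / 2, fun x hx => ?_⟩
    have h1 := hC x hx
    have h2 := hK x hx
    have h3 := hxlog x hx
    have hx0 : (0 : ℝ) ≤ x := Nat.cast_nonneg _
    have hx' : (2 : ℝ) ≤ x := by exact_mod_cast hx
    have hlogpos : 0 < Real.log (x : ℝ) := Real.log_pos (by linarith)
    have hxl0 : 0 ≤ (x : ℝ) * Real.log x := by positivity
    have hA := abs_nonneg (rootLevelConst g)
    have hAle := neg_abs_le (rootLevelConst g)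
    have hCle := le_abs_self C
    rw [abs_le] at h1
    nlinarith [h1.1, h1.2, mul_le_mul_of_nonneg_right hCle hx0, mul_le_mul_of_nonneg_right hAle hxl0]
  · rintro ⟨K, hK⟩
    refine ⟨2 * K + 2 * |rootLevelConst g| + 2 * |C|, fun x hx => ?_⟩
    have h1 := hC x hx
    have h2 := hK x hx
    have h3 := hxlog x hx
    have hx0 : (0 : ℝ) ≤ x := Nat.cast_nonneg _
    have hx' : (2 : ℝ) ≤ x := by exact_mod_cast hx
    have hlogpos : 0 < Real.log (x : ℝ) := Real.log_pos (by linarith)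
    have hxl0 : 0 ≤ (x : ℝ) * Real.log x := by positivity
    have hAle := le_abs_self (rootLevelConst g)
    have hCle := le_abs_self C
    rw [abs_le] at h1
    nlinarith [h1.1, h1.2, mul_le_mul_of_nonneg_right hCle hx0, mul_le_mul_of_nonneg_right hAle hxl0]

/-- **Secondary-term form**: `(∃ K, ∀ x ≥ 2, S_g(x) − 2A_g x log x ≤ Kx) ⟺ (∃ K', ∀ x ≥ 2, Mid_g(x) ≤ K'x)` — an `O(x)`
secondary term in Erdős's sum is the same thing as a linear bound for the located root count. [this work] -/
theorem polyDivisorSum_sub_log_upper_iff {g : ℤ[X]} (hirr : Irreducible g) (hdeg : 2 ≤ g.natDegree) :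
    (∃ K : ℝ, ∀ x : ℕ, 2 ≤ x →
        (polyDivisorSum g x : ℝ) - 2 * rootLevelConst g * (x : ℝ) * Real.log x ≤ K * x) ↔
      (∃ K : ℝ, ∀ x : ℕ, 2 ≤ x → (polyLocatedRootCount g x : ℝ) ≤ K * x) := by
  obtain ⟨C, hC⟩ := exists_abs_polyDivisorSum_sub_located_sub_log_le_of_two_le hirr hdeg
  constructor
  · rintro ⟨K, hK⟩
    refine ⟨(K + C) / 2, fun x hx => ?_⟩
    have h1 := hC x hx
    have h2 := hK x hx
    rw [abs_le] at h1
    linarith [h1.1, h1.2]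
  · rintro ⟨K, hK⟩
    refine ⟨2 * K + C, fun x hx => ?_⟩
    have h1 := hC x hx
    have h2 := hK x hx
    rw [abs_le] at h1
    linarith [h1.1, h1.2]

/-- **Two-sided located sandwich**: `2A_g x log x − Cx ≤ S_g(x) ≤ 2A_g x log x + Cx + 2Mid_g(x)` for `x ≥ 2` — all the
excess of Erdős's sum over its explicit main term is carried by the located root count. [this work] -/
theorem exists_polyDivisorSum_sandwich {g : ℤ[X]} (hirr : Irreducible g) (hdeg : 2 ≤ g.natDegree) :
    ∃ C : ℝ, ∀ x : ℕ, 2 ≤ x →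
      2 * rootLevelConst g * (x : ℝ) * Real.log x - C * x ≤ (polyDivisorSum g x : ℝ) ∧
        (polyDivisorSum g x : ℝ) ≤
          2 * rootLevelConst g * (x : ℝ) * Real.log x + C * x + 2 * (polyLocatedRootCount g x : ℝ) := by
  obtain ⟨C, hC⟩ := exists_abs_polyDivisorSum_sub_located_sub_log_le_of_two_le hirr hdeg
  refine ⟨C, fun x hx => ?_⟩
  have h1 := hC x hx
  have h0 : (0 : ℝ) ≤ polyLocatedRootCount g x := Nat.cast_nonneg _
  rw [abs_le] at h1
  constructor <;> linarith [h1.1, h1.2]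

end Summit.Parity.BatemanHorn.Theorems
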